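import Mathlib
import Summits.Ventures.FusionMHD.Bench.SAlphaS125W075A075Panels2
import Summits.Ventures.FusionMHD.Bench.SAlphaS125W075A0775Panels2
import Literature.MathematicalPhysics.MHD.BallooningSAlphaWitnessInterval
import Summits.Ventures.FusionMHD.Models.SAlphaStableS125A0725
import HarnessLib

/-!
# F3 — THIRD-ROUND HALF-GAP END MOVE AT SHEAR `s = 5/4` (UPPER END ALONE): `3/4 ∈ U_{5/4}` — with gridfusion-lit-4's
# `SAlphaStableS125A0725.stableSide : SAlpha.StableSide (5/4) (29/40)` (the LOWER end of the bracket of record, BY NAME, p628966) the first-stability edge of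
# the `s–α` MODEL at `s = 5/4` lies in `[29/40, 3/4]` (width `1/40` = HALF of the s = 5/4 second-round joint row (lit-4 `SAlphaStableS125A0725` + model-7 `Bench/BallooningSAlphaEndMoveS125A0775`, after ★ #271's `[7/10, 4/5]`)'s `[29/40, 31/40]`); and `U_{5/4} ⊇ [3/4, 31/40]` by ONE trial function
(venture LADDER-GRIDFUSION, rung F3; cell `gridfusion`; gridfusion-model-7 (g10), 2026-08-28, in gridfusion-lit-3's finite-element lane.
DIRECTOR RULING 67 (3) / lead RULINGS 9gl, 9gu (3): a COUNTED half-gap END MOVE is a tree theorem putting the edge inside a sub-interval of at most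
half the width of the bracket of record; at `s = 5/4` the bracket of record is the s = 5/4 second-round joint row (lit-4 `SAlphaStableS125A0725` + model-7 `Bench/BallooningSAlphaEndMoveS125A0775`, after ★ #271's `[7/10, 4/5]`)'s `[29/40, 31/40]` (width `1/20`); the float edge
`0.745` lies in its LOWER half, so the UPPER end alone halves it: `[29/40, 3/4]` (width `1/40`).)

WHAT IS PROVED (kernel, std axioms; the 2 × 48 interval integrals are `decide +kernel` facts of the 6 Panels files):
* `unstableWitness_075 : UnstableWitness (5/4) (3/4) (−48) 48 X X′` and `unstableWitness_0775 : UnstableWitness (5/4) (31/40) (−48) 48 X X′` for the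
  SAME explicit `C²` piecewise-quintic `X = trialX 1 1 pieces (−48)` (`2⁶⁰·W ≤` the printed negative integers);
* `unstableWitness_band : ∀ α ∈ Icc (3/4) (31/40), UnstableWitness (5/4) α (−48) 48 X X′` (lit-3's `unstableWitness_of_mem_Icc`), `not_stableSide_of_mem_band`;
* ★★★ `endMove_fiveQuarters_third : StableSide (5/4) (29/40) ∧ ¬ StableSide (5/4) (3/4)` — the END MOVE in one statement (lower end = `SAlphaStableS125A0725.stableSide` BY NAME).

## THREE COLUMNS
CERTIFIED: in the `s–α` ballooning MODEL at shear `s = 5/4`, with `U_{5/4}` = the set of `α` at which some compact window carries an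
instability witness (lit-3's `SAlpha.UnstableWitness`): `29/40 ∉ U` (gridfusion-lit-4, Picone/Riccati core + tail) and `[3/4, 31/40] ⊆ U` (this file) ⇒
`inf {α ≥ 29/40 : α ∈ U} ∈ [29/40, 3/4]` CLOSED, width `1/40`; with `model-7's `Bench/SAlphaS125W0775.unstableWitness_0775` (`31/40`), `SAlphaPolyWitnessS125A08` (`4/5`) and ★ #250's lens` the certified unstable set at `s = 5/4` stays ONE
connected interval from `3/4` up to `lensHi (5/4)`.  Monotonicity / continuity of the edge in `α` NOT typed.  VALIDATED (not in the kernel): E–L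
shooting edge `α ≈ 0.745` (lit-4 kit j299948); float energies above; the printed fit `α ≈ 0.6 s` (12.100) gives `0.75`.  MODELLED: `s–α` model
(large-aspect-ratio shifted circles, high-`n` ballooning ordering, `θ₀ = 0`, ideal MHD); «unstable» = the MODEL's one-surface energy admits a negative
compactly supported `C¹` trial function (representation step `W̄ < 0 ⇒ δW < 0`, Connor–Hastie–Taylor 1979, quoted in the Literature file, NOT typed);
no device, no `β`-limit, no second-stability claim here.  Citations: Freidberg 2014 §8.7 (p0318), §12.3 (12.38)–(12.40), §12.6.2 (12.96)–(12.100)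
[Freidberg2014]; Mahboubi–Melquiond–Sibut-Pinote 2016 §3.2–3.3 [MahboubiMelquiondSibutpinote2016].
-/

open Literature.Analysis.ValidatedNumerics Literature.Analysis.ValidatedNumerics.PolyMP
open Literature.Analysis.ValidatedNumerics.NumericsMP Literature.Analysis.ValidatedNumerics.ExpPoly
open Literature.MathematicalPhysics.MHD.Ballooning Literature.MathematicalPhysics.MHD.Ballooning.SAlpha
open Literature.MathematicalPhysics.MHD.Ballooning.SAlpha.Spline
open Set

namespace Summit.Ventures.FusionMHD.Bench.SAlphaS125W075

/-- THE GLUED SEGMENT at `α = 3/4` in summed form. [cite: MahboubiMelquiondSibutpinote2016, Sect. 3.3] -/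
theorem c075_seg_all :
    FSegOK (splineDensity (5/4) (3/4) (-48) 1 1 pieces) [1] (2 ^ 60) (panelLeft 1 0) (panelLeft 1 48) (-11686359280386048) (-11686357220982784) := by
  have h := c075_seg
  norm_num at h
  exact h

/-- THE `[-48, 48]` TRIAL FUNCTION IS A WITNESS AT `(5/4, 3/4)`: `UnstableWitness 5/4 (3/4) (-48) 48 X X′`, `2⁶⁰·W ≤ -11686357220982784` (`W ≈ -0.0101`;
enclosure `[-0.0101363, -0.0101363]`). [cite: Freidberg2014, §12.3 eqs. (12.38)–(12.40)] -/
theorem unstableWitness_075 :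
    UnstableWitness (5/4) (3/4) (-48) 48 (trialX 1 1 pieces (-48)) (trialX' 1 1 pieces (-48)) := by
  have h := unstableWitness_of_spline (s := 5/4) (α := 3/4) (a := -48) (h := 1) (m := 1) (ps := pieces)
    one_pos one_pos pieces_ne_nil pieces_match pieces_deriv_match head_zero last_zero c075_seg_all (by decide)
  rw [pieces_length] at h
  norm_num at h
  exact h

/-- THE GLUED SEGMENT at `α = 31/40` in summed form. [cite: MahboubiMelquiondSibutpinote2016, Sect. 3.3] -/
theorem c0775_seg_all :
    FSegOK (splineDensity (5/4) (31/40) (-48) 1 1 pieces) [1] (2 ^ 60) (panelLeft 1 0) (panelLeft 1 48) (-79091964162605056) (-79091961966886912) := by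
  have h := c0775_seg
  norm_num at h
  exact h

/-- THE `[-48, 48]` TRIAL FUNCTION IS A WITNESS AT `(5/4, 31/40)`: `UnstableWitness 5/4 (31/40) (-48) 48 X X′`, `2⁶⁰·W ≤ -79091961966886912` (`W ≈ -0.0686`;
enclosure `[-0.0686013, -0.0686013]`). [cite: Freidberg2014, §12.3 eqs. (12.38)–(12.40)] -/
theorem unstableWitness_0775 :
    UnstableWitness (5/4) (31/40) (-48) 48 (trialX 1 1 pieces (-48)) (trialX' 1 1 pieces (-48)) := by
  have h := unstableWitness_of_spline (s := 5/4) (α := 31/40) (a := -48) (h := 1) (m := 1) (ps := pieces)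
    one_pos one_pos pieces_ne_nil pieces_match pieces_deriv_match head_zero last_zero c0775_seg_all (by decide)
  rw [pieces_length] at h
  norm_num at h
  exact h

/-- ★★ THE BAND: the `[-48, 48]` trial function is a witness at EVERY `α ∈ [3/4, 31/40]` (the energy of a fixed trial function is a convex
quadratic polynomial in `α`): `U_{5/4} ⊇ [3/4, 31/40]`. [cite: Freidberg2014, §12.3 eqs. (12.38)–(12.40)] («… The plasma is unstable», for the band of the MODEL) -/
theorem unstableWitness_band :
    ∀ α ∈ Icc (3/4 : ℝ) (31/40), UnstableWitness (5/4) α (-48) 48 (trialX 1 1 pieces (-48)) (trialX' 1 1 pieces (-48)) :=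
  unstableWitness_of_mem_Icc unstableWitness_075 unstableWitness_0775

/-- … hence every point of the band carries SOME witness, [cite: Freidberg2014, §12.3 eqs. (12.38)–(12.40)] -/
theorem exists_unstableWitness_of_mem_band {α : ℝ} (hα : α ∈ Icc (3/4 : ℝ) (31/40)) :
    ∃ a b : ℝ, ∃ X X' : ℝ → ℝ, UnstableWitness (5/4) α a b X X' :=
  ⟨_, _, _, _, unstableWitness_band α hα⟩

/-- … and none is on the stable side. [cite: Freidberg2014, §12.3 eq. (12.40)] -/
theorem not_stableSide_of_mem_band {α : ℝ} (hα : α ∈ Icc (3/4 : ℝ) (31/40)) : ¬ StableSide (5/4) α := by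
  obtain ⟨a, b, X, X', hw⟩ := exists_unstableWitness_of_mem_band hα
  exact fun hs => hs a b X X' hw

/-- ★★★ THE THIRD-ROUND HALF-GAP END MOVE AT `s = 5/4` IN ONE STATEMENT: the lower end `29/40` is on the STABLE side (gridfusion-lit-4's
`SAlphaStableS125A0725.stableSide`, BY NAME) and `3/4` is NOT (this file's witness) — the first-stability edge of the MODEL at `s = 5/4` lies in the
closed interval `[29/40, 3/4]` of width `1/40`. [cite: Freidberg2014, §12.3 eqs. (12.38)–(12.40)] -/
theorem endMove_fiveQuarters_third :
    StableSide (5/4) (29/40) ∧ ¬ StableSide (5/4) (3/4) :=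
  ⟨Summit.Ventures.FusionMHD.Models.SAlphaStableS125A0725.stableSide,
   not_stableSide_of_mem_band ⟨le_rfl, by norm_num⟩⟩

end Summit.Ventures.FusionMHD.Bench.SAlphaS125W075
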